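import Literature.MathematicalPhysics.QuantumFieldTheory.Balaban1983to89.B9RWSumsDefinitePinsPairMDirA
import Literature.MathematicalPhysics.QuantumFieldTheory.Balaban1983to89.B9RWSumsAllBlocksPairMDir3
import Literature.MathematicalPhysics.QuantumFieldTheory.Balaban1983to89.B9RWSumsAllBlocksPairMGDir3

/-!
# `Balaban1983to89.B9RWSumsDefinitePinsPairMDir3` — rows 13 ∕ 18 ∕ 19 of the N06 census at def-Y's members with definite expansion data, both sides over the
# direction letters, ₃ EDITION: the second-order pair families by the LEFT Neumann series — dag-n06-c's `B9RWSumsDefinitePinsPairMDir.thm37_cor38_complete_geo9Y_pairM_dir`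
# (§1), `B9RWSumsDefinitePinsPairMDirA.thm310_complete_geo9Y_pairM_dir` (§2) and ★★★ `B9RWSumsDefinitePinsPairMDirA.rows131819_definite_geo9Y_pairM_dir₂` (§3, the
# consumer face) with the third-order schemas `FactorsL2Second37Dir ∕ FactorsL2Second310` REMOVED (file 8₃ of the record edition) — PART 1: §1 ∕ §2, THE TWO ONE-SIDED FACES (§3, the consumer face, is `B9RWSumsDefinitePinsPairMDir3Rows`)

T. Bałaban, *Propagators for lattice gauge theories in a background field*, Commun. Math. Phys. **99** (1985) 389–434
[`Balaban1985BackgroundPropagators`, "B9"], Thm 3.7 p. 409, Cor. 3.8 p. 410, Thm 3.10 (3.105)–(3.108) pp. 414–416, Thm 3.7 ⇒ Thm 3.1 p. 410, Thm 3.10 ⇒ Thm 3.3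
p. 416, (3.42)–(3.47) pp. 397–398, Cor. 3.6 p. 408; T. Bałaban, *Propagators and renormalization transformations for lattice gauge theories. II*, Commun. Math.
Phys. **96** (1984) 223–250 [`Balaban1984PropagatorsII`, "[4]"], (2.51)–(2.52) p. 232, Lemma 2.1 (2.59)–(2.61) pp. 233–234.

statement-level skeleton of published theorems with citation tags; proofs where landed; nothing here is a claim about the
Yang–Mills mass gap

WHY THIS FILE (cell `pub-ymgap`, Track A node N06 [B9]; width seat `pub-ymgap-dag-n06-w1` g5; dag-n06-w1 LOCATED-SCHEMA-1 bus l.38190, dag-n06-d g12 CALL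
l.38294 «the swap is WANTED», dag-n06-c g12 GO l.38793).  The v2∕v3 consumer faces carry, in the two-sided L² bundles `h36H ∕ h36HA`, the third-order schemas
`FactorsL2Second37Dir (𝔬 x) (𝔡 x) (𝔩 x) 1 (H x) p3.θ3 p.δ₀ U` and `FactorsL2Second310 (𝔬A x) (𝔡A x) 1 (H x) q3.θ3 q.δ₀ U` (a block bound `θ₃·len⁻²` on
`K(h)·G′_□M_h∇*∇*`), which are off print's scale (the true size is `θ·M⁻¹·len⁻¹·η⁻¹`, the UV derivative uneaten) and so have no faithful inhabitant.  Print's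
road (pp. 409–410, 416) is the LEFT Neumann series `G′∇*∇* = Σₙ(R′ᵀ)ⁿ·(G′₀∇*∇*)` — the transpose of `∇∇G′ = ∇∇G′₀·ΣₙR′ⁿ` — which needs only the kinematic letter
transposes `Gsqᵀ = Gsq`, `Pᵗ = Pᵀ`, `Cᵗ = Cᵀ` (G′ side) ∕ `Rₐᵗ = Rₐᵀ` (G side), all derivable at node00-def-Y's pins.  This file is the VERBATIM copy of the three
faces with exactly these edits: (i) the two schema conjuncts replaced by the transposes; (ii) the binders `θ3 ∕ hθ3` dropped in §1 ∕ §2 and `hB35` stated at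
`NQ·2N₃B₃`; (iii) §3 keeps the sign records `p3 q3 : PairPrims` (only `N3`, `B3` are read) and concludes at the v3 E-letters `E37YPairMDir ∕ E310YPairM` taken AT
THE RECORDS `⟨p3.N3, 2·p3.B3, 0⟩`, `⟨q3.N3, 2·q3.B3, 0⟩` — there `secondConst … N3 (2B3) … 0 … = 2N₃B₃`, so `B1PairM` and every numeric relation are reused with
no new constant letter; (iv) the engines are dag-n06-w1's `thm37Printed_allPin_completePairM_dir₃ ∕ thm310Printed_allPin_completePairM_dir₃` (one more «M large»
threshold each, absorbed in the members' `M₁`-strengthening exactly as before).  The private arithmetic helpers are copied.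

HONEST SCOPE.  Bookkeeping composition; every operator-level input is a HYPOTHESIS schema; nothing of [B9] asserted; COUNT-NEUTRAL; N06 NOT discharged; K1⁹
NOT closed; one finite lattice programme — nothing continuum, nothing about OS positivity or the mass gap; the YM mass gap (Clay) is NOT proved by any of
this — R4 closes the conditional finite-𝕋⁴ rung `BalabanLadder.UV` only.
-/

namespace Literature.MathematicalPhysics.QuantumFieldTheory.Balaban1983to89.B9RWSumsDefinitePinsPairMDir3

open Finset B6RandomWalk B9Thm34Ext B9Thm37Whole B9Cor38Whole B9Thm310Whole B9RowSum261Faces B9RowSum261DefiniteFaces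
open B9Ineq349Whole B9RWSums343to347Whole B9PinMembersKLevelV1 B9GeoLemma21KLevelV1 B9RWSums347DefiniteFaces
open B9Thm37GlueCor36 B9Thm37Glue B9RWSums346Schur B9RWSums343Holder B9RWSums343HolderGp B9RWSums346Lap B9RWSums344Input
open B9RWSums344InputGp B9RWSums346Two B9RWSums346TwoGp B11SectG B9RWSumsCompleteGeo9Y B9RWSumsDefinitePins
open B9CoRealizesRel B9RWSumsReadsRel B9RWSumsReadsNbr B9RWSumsAllBlocksNbr B9RWSumsCompleteGeo9YNbr
open B9RWSums346SecondDiff B9RWSums346SecondDiffGp B9RWSumsAllBlocksPair B9RWSumsCompleteGeo9YPair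
open B9RWSumsDefinitePinsNbr B9RWSumsDefinitePinsPair B9RWSums346MixedPair B9RWSums344InputFam B9RWSums344InputPair B9RWSumsAllBlocksPairM
open B9RWSumsCompleteGeo9YPairM B9RWSumsDefinitePinsPairM
open Literature.MathematicalPhysics.QuantumFieldTheory.Balaban1983to89.B9RWSumsCompleteGeo9Y (const37_nonneg_of_signs)
open B9Thm37WholeDir B9Thm37KLetterDir B9RWSums343HolderGpDir B9RWSumsAllBlocksPairMDir B9Cor38WholeDir B9RWSumsDefinitePinsPairMDir
open B9Thm310WholeDir B9RWSums343HolderDir B9RWSumsAllBlocksPairMGDir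
open B9RWSumsDefinitePinsPairMDirA B9RWSumsAllBlocksPairMDir3 B9RWSumsAllBlocksPairMGDir3

noncomputable section

section StageY

variable {d ℓ : ℕ} {hd : 1 ≤ d + 1} {hL : Odd (ℓ + 1) ∧ 1 < ℓ + 1} {b₀ b₁ : ℝ} {Mstar : ℕ}
variable [∀ x : MemberY d ℓ hd hL b₀ b₁ Mstar, Fintype (geo9Y x).Site]
  [∀ x : MemberY d ℓ hd hL b₀ b₁ Mstar, DecidableEq (geo9Y x).Site]
variable {c35 : ℝ} {bg : MemberY d ℓ hd hL b₀ b₁ Mstar → B9.Backgrounds}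

/-! ## §1 Rows 13 ∕ 18, G′ side: Theorem 3.7 ∧ Corollary 3.8 at the literal all-blocks datum, ₃ edition -/

/-- ★★ **(₃ EDITION — second-order pair families by the LEFT Neumann series: `h36H`'s third-order schema `FactorsL2Second37Dir … θ3 δ₀` REPLACED by the kinematic letter transposes `Gsqᵀ = Gsq`, `Pᵗ = Pᵀ`, `Cᵗ = Cᵀ`; `θ3 ∕ hθ3` dropped; `hB35` at `NQ·2N₃B₃`; through dag-n06-w1's `B9RWSumsAllBlocksPairMDir3.thm37Printed_allPin_completePairM_dir₃`; everything else VERBATIM the v2 text that follows.)** **(v2 OVER THE DIRECTION LETTERS, ruling R1′: `h36 ∋ DirSupSq37 ∧ Identities₂`, `h36H ∋ HolderV37Dir ∕ FactorsL2Second37Dir ∕ FactorsInputPair37Dir ∕ FactorsL2Mixed37Dir`, datum `W38OfOpsDir`, locality `LocalityDir`; inside `thm37_cor38_W38OfOps_exp261_geo9Y₂` + `thm37Printed_allPin_completePairM_dir`; everything else VERBATIM `B9RWSumsCompleteGeo9YPairM.thm37_cor38_complete_geo9Y_pairM`.) THEOREM 3.7 ∧ COROLLARY 3.8 AT THE LITERAL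 ALL-BLOCKS DATUM OVER def-Y's MEMBERS, FROM OPERATOR-LEVEL INPUTS ONLY, THE (3.43)–(3.46) CO-READINGS SITED ON THE NEIGHBOURHOOD OF RADIUS 2** (the `Nbr` form of `B9RWSumsCompleteGeo9YRel.thm37_cor38_complete_geo9Y_rel`, on `B9RWSumsAllBlocksNbr.thm37Printed_allPin_completeNbr`; the triangle inequality, symmetry and level comparability of `geo9Y` supplied by name; class multiplicity ≦ m, neighbourhood count ≦ mN and evaluation constant Cev folded into the constants' relations).
With `C := const37 (exp261 geo9Y δ₀ α) δ₀ α ρ B₀ N N′ C_ℓ K_c`, `δ := (1 − 2α)δ₀` and the datum `E37AllOfOps (W38OfOpsDir (𝔬 x) (𝔡 x) (𝔩 x) (rd x)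
1 (H x) C δ) (𝔬 x) 1 (H x) C δ (K x) B₁ δ₁ Bβ Bε Bεβ` (p. 409 (3.90) with p. 410's *"convergent in all norms appearing in the
inequalities (3.42)–(3.47)"* READ as Theorem 3.1's typed blocks for the kernel family `K x`): the leaf `B9.Thm37Printed` AND the
leaf `B9.Cor38Printed` hold, given — the static data; Corollary 3.6's blocks for the G′_□ and the structure (3.88) (`h36`), the
Hölder ∕ V-term ∕ Laplacian ∕ input ∕ two-sided L² legs (`h36H`) at (B₀, δ₀), all POSITED for M ≧ M₁, 0 < α₀,
O(1)Mα₀ ≦ a₁, (3.35); the co-readings of `K x`; the transpose letters; the support counts; the signs; and the relations of the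
all-blocks constants (B₁, δ₁, Bβ, Bε, Bεβ) to the derived ones.  [4] Lemma 2.1 ((2.60), (2.61), the size condition), 1 ≦ L ≦ ℓ + 1,
η > 0 and d(a, b) = d(b, a) come from the record (`lemma21Pack_geo9Y`, `geo9Y_dist_symm`); the sup-block leaf from
`thm37_cor38_W38OfOps_exp261_geo9Y`; the rest is `B9RWSumsAllBlocksNbr.thm37Printed_allPin_completeNbr`.  Nothing of print asserted; NOT a
node discharge. [cite: Balaban1985BackgroundPropagators, Thm 3.7 (3.90) pp.409–410 + Cor. 3.8 (3.94) p.410 + Cor. 3.6 p.408 + (3.42)–(3.47) pp.397–398; Balaban1984PropagatorsII, Lemma 2.1 (2.59)–(2.61) pp.233–234] -/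
theorem thm37_cor38_complete_geo9Y_pairM_dir₃ {X Y ι PX PY Q : MemberY d ℓ hd hL b₀ b₁ Mstar → Type} [∀ x, Fintype (X x)]
    [∀ x, DecidableEq (X x)] [∀ x, Fintype (Y x)] [∀ x, DecidableEq (Y x)] [∀ x, Fintype (ι x)] [∀ x, Fintype (PX x)]
    [∀ x, DecidableEq (PX x)] [∀ x, Fintype (PY x)] [∀ x, DecidableEq (PY x)] [∀ x, Fintype (Q x)]
    (𝔬 : ∀ x : MemberY d ℓ hd hL b₀ b₁ Mstar, Ops (geo9Y x) (bg x) (X x) (Y x) (ι x))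
    (rd : ∀ x : MemberY d ℓ hd hL b₀ b₁ Mstar, WalkReading (geo9Y x) (bg x) (X x) (ι x))
    (H : MemberY d ℓ hd hL b₀ b₁ Mstar → Prop)
    (𝔭 : ∀ x : MemberY d ℓ hd hL b₀ b₁ Mstar, HolderProbes (geo9Y x) (bg x) (X x) (Y x) (PX x) (PY x))
    (𝔡 : ∀ x : MemberY d ℓ hd hL b₀ b₁ Mstar, DirOps37 (𝔬 x) (Q x))
    (𝔩 : ∀ x : MemberY d ℓ hd hL b₀ b₁ Mstar, DirLetters37 (𝔬 x) (Q x))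
    (bHX : ∀ x : MemberY d ℓ hd hL b₀ b₁ Mstar, ℝ → BlockNorm (toB6 (geo9Y x) 1 (H x)) (X x → ℝ))
    (K : ∀ x : MemberY d ℓ hd hL b₀ b₁ Mstar, B9.KernelFamily (geo9Y x) (bg x))
    (ev : ∀ x : MemberY d ℓ hd hL b₀ b₁ Mstar, (geo9Y x).Loc → X x → ℝ)
    (evY : ∀ x : MemberY d ℓ hd hL b₀ b₁ Mstar, (geo9Y x).Loc → Y x → ℝ)
    (Rel : ∀ x : MemberY d ℓ hd hL b₀ b₁ Mstar, (geo9Y x).Site → (geo9Y x).Site → Prop) [∀ x, DecidableRel (Rel x)] (m : ℕ)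
    (Cev : ℝ) (mN : ℕ)
    (hRlen : ∀ x (a a' : (geo9Y x).Site), Rel x a a' → (geo9Y x).len a = (geo9Y x).len a')
    (hRd₁ : ∀ x (a a' b : (geo9Y x).Site), Rel x a a' → (geo9Y x).dist a b = (geo9Y x).dist a' b)
    (hRd₂ : ∀ x (a b b' : (geo9Y x).Site), Rel x b b' → (geo9Y x).dist a b = (geo9Y x).dist a b')
    (hmult : ∀ x (y' : (geo9Y x).Site), (Finset.univ.filter (fun y'' => Rel x y'' y')).card ≤ m)
    (hnbr : ∀ (x : MemberY d ℓ hd hL b₀ b₁ Mstar) (y : (geo9Y x).Site), (nbr (geo9Y x) 2 y).card ≤ mN) (hCev : 0 ≤ Cev)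
    (κ : MemberY d ℓ hd hL b₀ b₁ Mstar → Sizes) (SH S3 SI SM : ∀ x : MemberY d ℓ hd hL b₀ b₁ Mstar, ι x → Finset (geo9Y x).Site)
    (Bl BV BI θI : ℝ → ℝ) (BI2 : ℝ → ℝ → ℝ)
    (α ρ N N' Cℓ Kc θ₀ B₀ δ₀ a₁ M₁ αF NH N3 B3 NQ NI NM BM θM : ℝ) {B₁ δ₁ : ℝ} {Bβ Bε : ℝ → ℝ} {Bεβ : ℝ → ℝ → ℝ}
    (hc : 0 < c35) (hα : 0 < α) (hα2 : α < 1 / 2) (hN : 0 ≤ N) (hN' : 0 ≤ N') (hCℓ : 1 ≤ Cℓ) (hK : 0 ≤ Kc) (hθ₀ : 0 ≤ θ₀)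
    (hB₀ : 0 < B₀) (hδ₀ : 0 < δ₀) (ha₁ : 0 < a₁) (hM₁ : 0 < M₁) (hαF : 0 < αF) (hαF2 : αF ≤ 1 / 2) (hNH : 0 ≤ NH)
    (hN3 : 0 ≤ N3) (hB3 : 0 ≤ B3) (hNI : 0 ≤ NI) (hNM : 0 ≤ NM) (hBM : 0 ≤ BM) (hθM : 0 ≤ θM)
    (hst : ∀ x, StaticOK (𝔬 x) ρ N N' Cℓ (κ x)) (hκ : ∀ x, (κ x).Bounded Kc θ₀ Cℓ (geo9Y x).M)
    (hrd : ∀ x, (rd x).OK (𝔬 x).blk) (hloc : ∀ x, LocalityDir (𝔬 x) (𝔡 x) (𝔩 x) (rd x))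
    (h36 : ∀ x, M₁ ≤ (geo9Y x).M → ∀ α₀ : ℝ, 0 < α₀ → c35 * (geo9Y x).M * α₀ ≤ a₁ →
      ∀ U : (bg x).Cfg, (bg x).Reg335 c35 α₀ U →
        Local342 (𝔬 x) 1 (H x) B₀ δ₀ U ∧ DirSupSq37 (𝔬 x) (𝔡 x) 1 (H x) U ∧ Identities₂ (𝔬 x) (𝔡 x) (𝔩 x) 1 (H x) U)
    (h36H : ∀ x, M₁ ≤ (geo9Y x).M → ∀ α₀ : ℝ, 0 < α₀ → c35 * (geo9Y x).M * α₀ ≤ a₁ →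
      ∀ U : (bg x).Cfg, (bg x).Reg335 c35 α₀ U →
        HolderLegs37 (𝔬 x) (𝔭 x) 1 (H x) (SH x) Bl δ₀ U ∧ HolderV37Dir (𝔬 x) (𝔡 x) (𝔩 x) (𝔭 x) 1 (H x) BV δ₀ U ∧
          (L2SecondLegs37 (𝔬 x) (𝔡 x) 1 (H x) (S3 x) B3 δ₀ U ∧ (∀ q, IsTransposePair ((𝔬 x).Gsq U q) ((𝔬 x).Gsq U q)) ∧
            (∀ q μ, IsTransposePair ((𝔩 x).Pt U q μ) ((𝔩 x).P U q μ)) ∧ (∀ q, IsTransposePair ((𝔬 x).Ct U q) ((𝔬 x).Cop U q)) ∧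
            DirTranspose37 (𝔬 x) (𝔡 x) U) ∧
            (InputLegsPair37 (𝔬 x) (𝔡 x) (𝔭 x) 1 (H x) (bHX x) (SI x) BI BI2 δ₀ U ∧
              FactorsInputPair37Dir (𝔬 x) (𝔡 x) (𝔩 x) 1 (H x) (bHX x) θI δ₀ U ∧ DirSupHolder37 (𝔬 x) (𝔡 x) (𝔭 x) 1 (H x) U) ∧
              (L2MixedLegs37 (𝔬 x) (𝔡 x) 1 (H x) (SM x) BM δ₀ U ∧ FactorsL2Mixed37Dir (𝔬 x) (𝔡 x) (𝔩 x) 1 (H x) θM δ₀ U ∧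
                DirSup37 (𝔬 x) (𝔡 x) 1 (H x) U))
    (hco0 : ∀ x U, CoRealizesRel (K x) 0 U (Rel x) (𝔬 x).blk (𝔬 x).blk (ev x) ((𝔬 x).Gp U))
    (hco1 : ∀ x U, CoRealizesRel (K x) 1 U (Rel x) (𝔬 x).blkY (𝔬 x).blk (ev x) ((𝔬 x).D U ∘ₗ (𝔬 x).Gp U))
    (hco2 : ∀ x U, CoRealizesRel (K x) 2 U (Rel x) (𝔬 x).blk (𝔬 x).blkY (evY x) ((𝔬 x).Gp U ∘ₗ (𝔬 x).Dstar U))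
    (hco3 : ∀ x U, CoRealizesRel (K x) 3 U (Rel x) (𝔬 x).blk (𝔬 x).blk (ev x) ((𝔬 x).Lap U ∘ₗ (𝔬 x).Gp U))
    (hgl0 : ∀ x U, GlobReads (K x) 0 U (𝔬 x).blk (𝔬 x).blk (ev x) ((𝔬 x).Gp U))
    (hgl1 : ∀ x U, GlobReads (K x) 1 U (𝔬 x).blkY (𝔬 x).blk (ev x) ((𝔬 x).D U ∘ₗ (𝔬 x).Gp U))
    (hgl2 : ∀ x U, GlobReads (K x) 2 U (𝔬 x).blk (𝔬 x).blkY (evY x) ((𝔬 x).Gp U ∘ₗ (𝔬 x).Dstar U))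
    (hgl3 : ∀ x U, GlobReads (K x) 3 U (𝔬 x).blk (𝔬 x).blk (ev x) ((𝔬 x).Lap U ∘ₗ (𝔬 x).Gp U))
    (hl0 : ∀ x U, L2ReadsNbr (R := 1) (H := H x) (K x) 0 U (Rel x) 2 Cev (𝔬 x).blk (𝔬 x).blk (ev x) ((𝔬 x).Gp U))
    (hl1 : ∀ x U, L2ReadsNbr (R := 1) (H := H x) (K x) 1 U (Rel x) 2 Cev (𝔬 x).blkY (𝔬 x).blk (ev x) ((𝔬 x).D U ∘ₗ (𝔬 x).Gp U))
    (hl2 : ∀ x U, L2ReadsNbr (R := 1) (H := H x) (K x) 2 U (Rel x) 2 Cev (𝔬 x).blk (𝔬 x).blkY (evY x) ((𝔬 x).Gp U ∘ₗ (𝔬 x).Dstar U))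
    (hl3 : ∀ x U, L2ReadsNbr (R := 1) (H := H x) (K x) 3 U (Rel x) 2 Cev ((𝔬 x).blk ∘ Prod.fst) (𝔬 x).blk (ev x)
      (familyOp fun p : Q x × Q x => (𝔡 x).Dd U p.1 ∘ₗ ((𝔬 x).Gp U ∘ₗ (𝔡 x).Dsd U p.2)))
    (hl4 : ∀ x U, L2ReadsNbr (R := 1) (H := H x) (K x) 4 U (Rel x) 2 Cev ((𝔬 x).blk ∘ Prod.fst) (𝔬 x).blk (ev x)
      (familyOp fun p : Q x × Q x => ((𝔡 x).Dd U p.1 ∘ₗ (𝔡 x).Dd U p.2) ∘ₗ (𝔬 x).Gp U))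
    (hl5 : ∀ x U, L2ReadsNbr (R := 1) (H := H x) (K x) 5 U (Rel x) 2 Cev ((𝔬 x).blk ∘ Prod.fst) (𝔬 x).blk (ev x)
      (familyOp fun p : Q x × Q x => (𝔬 x).Gp U ∘ₗ ((𝔡 x).Dsd U p.1 ∘ₗ (𝔡 x).Dsd U p.2)))
    (hH1 : ∀ x U, H1ReadsNbr (K x) U (𝔭 x) (Rel x) 2 (𝔬 x).blk (𝔬 x).blkY (ev x) (evY x) ((𝔬 x).D U ∘ₗ (𝔬 x).Gp U)
      ((𝔬 x).Gp U ∘ₗ (𝔬 x).Dstar U))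
    (hIR : ∀ x U, InputReadsFam (K x) U (bHX x) 2 ((𝔬 x).blk ∘ Prod.fst) ((𝔭 x).blkPX ∘ Prod.fst)
      (fun β => sliceProbe ((𝔭 x).ΦX U β)) (ev x)
      (familyOp fun p : Q x × Q x => (𝔡 x).Dd U p.1 ∘ₗ ((𝔬 x).Gp U ∘ₗ (𝔡 x).Dsd U p.2)))
    (hsym : ∀ x, M₁ ≤ (geo9Y x).M → ∀ α₀ : ℝ, 0 < α₀ → c35 * (geo9Y x).M * α₀ ≤ a₁ →
      ∀ U : (bg x).Cfg, (bg x).Reg335 c35 α₀ U → IsTransposePair ((𝔬 x).Gp U) ((𝔬 x).Gp U))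
    (htr : ∀ x, M₁ ≤ (geo9Y x).M → ∀ α₀ : ℝ, 0 < α₀ → c35 * (geo9Y x).M * α₀ ≤ a₁ →
      ∀ U : (bg x).Cfg, (bg x).Reg335 c35 α₀ U → IsTransposePair ((𝔬 x).D U ∘ₗ (𝔬 x).Gp U) ((𝔬 x).Gp U ∘ₗ (𝔬 x).Dstar U))
    (hcntH : ∀ x (a : (geo9Y x).Site), (∑ q, if a ∈ SH x q then (1 : ℝ) else 0) ≤ NH)
    (hcnt3 : ∀ x (a : (geo9Y x).Site), (∑ q, if a ∈ S3 x q then (1 : ℝ) else 0) ≤ N3)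
    (hNQ : ∀ x, (Fintype.card (Q x) : ℝ) ≤ NQ)
    (hcntI : ∀ x (a : (geo9Y x).Site), (∑ q, if a ∈ SI x q then (1 : ℝ) else 0) ≤ NI)
    (hcntM : ∀ x (a : (geo9Y x).Site), (∑ q, if a ∈ SM x q then (1 : ℝ) else 0) ≤ NM)
    (hBl : ∀ β, 0 ≤ β → β < 1 → 0 ≤ Bl β) (hBV : ∀ β, 0 ≤ β → β < 1 → 0 ≤ BV β)
    (hBI : ∀ ε, 0 < ε → ε ≤ 1 → 0 ≤ BI ε) (hBI2 : ∀ ε β, 0 < ε → ε ≤ 1 → 0 ≤ β → β < 1 → 0 ≤ BI2 ε β)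
    (hθI : ∀ ε, 0 < ε → 0 ≤ θI ε)
    -- the relations of the all-blocks constants (B₁, δ₁, Bβ, Bε, Bεβ) to the definite derived ones
    (hCB : (m : ℝ) * const37 (exp261 (@geo9Y d ℓ hd hL b₀ b₁ Mstar) δ₀ α) δ₀ α ρ B₀ N N' Cℓ Kc ≤ B₁)
    (hCL : (mN : ℝ) * m * Cev * (((ℓ + 1 : ℕ) : ℝ)) ^ 2 * Real.exp (2 * δ₁) * 
      (const37 (exp261 (@geo9Y d ℓ hd hL b₀ b₁ Mstar) δ₀ α) δ₀ α ρ B₀ N N' Cℓ Kc * ((ℓ + 1 : ℕ) : ℝ)) ≤ B₁)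
    (hδ₁nn : 0 ≤ δ₁) (hδ₁ : δ₁ ≤ (1 - 2 * αF) * ((1 - 2 * α) * δ₀))
    (hCg : const37 (exp261 (@geo9Y d ℓ hd hL b₀ b₁ Mstar) δ₀ α) δ₀ α ρ B₀ N N' Cℓ Kc *
      B6.c1 (exp261 (@geo9Y d ℓ hd hL b₀ b₁ Mstar) ((1 - 2 * α) * δ₀) (1 - αF)) ((1 - 2 * α) * δ₀) (1 - αF) *
        ((ℓ + 1 : ℕ) : ℝ) ^ (4 : ℝ) ≤ B₁)
    (hB35 : (mN : ℝ) * m * Cev * (((ℓ + 1 : ℕ) : ℝ)) ^ 2 * Real.exp (2 * δ₁) * 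
      (NQ * (2 * (N3 * B3))) ≤ B₁)
    (hB3M : (mN : ℝ) * m * Cev * (((ℓ + 1 : ℕ) : ℝ)) ^ 2 * Real.exp (2 * δ₁) *
      (NQ * mixedConst (exp261 (@geo9Y d ℓ hd hL b₀ b₁ Mstar) δ₀ α) δ₀ α NM BM N' θM
        (const37 (exp261 (@geo9Y d ℓ hd hL b₀ b₁ Mstar) δ₀ α) δ₀ α ρ B₀ N N' Cℓ Kc) ((ℓ + 1 : ℕ) : ℝ)) ≤ B₁)
    (hBβ : ∀ β, 0 ≤ β → β < 1 →
      (m : ℝ) * ((ℓ + 1 : ℕ) : ℝ) * Real.exp (2 * δ₁) * holderConst (exp261 (@geo9Y d ℓ hd hL b₀ b₁ Mstar) δ₀ α) δ₀ α NH N'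
        (const37 (exp261 (@geo9Y d ℓ hd hL b₀ b₁ Mstar) δ₀ α) δ₀ α ρ B₀ N N' Cℓ Kc) (Bl β) (BV β) ≤ Bβ β)
    (hBε : ∀ ε, 0 < ε → ε ≤ 1 →
      Real.exp (2 * δ₁) * inputConst44 (exp261 (@geo9Y d ℓ hd hL b₀ b₁ Mstar) δ₀ α) δ₀ α NI N'
        (const37 (exp261 (@geo9Y d ℓ hd hL b₀ b₁ Mstar) δ₀ α) δ₀ α ρ B₀ N N' Cℓ Kc) ((ℓ + 1 : ℕ) : ℝ) (BI ε) (θI ε) ≤ Bε ε)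
    (hBεβ : ∀ ε β, 0 < ε → ε ≤ 1 → 0 ≤ β → β < 1 →
      ((ℓ + 1 : ℕ) : ℝ) * Real.exp (2 * δ₁) * inputConst45 (exp261 (@geo9Y d ℓ hd hL b₀ b₁ Mstar) δ₀ α) δ₀ α NI N' ((ℓ + 1 : ℕ) : ℝ)
        (holderConst (exp261 (@geo9Y d ℓ hd hL b₀ b₁ Mstar) δ₀ α) δ₀ α NH N'
          (const37 (exp261 (@geo9Y d ℓ hd hL b₀ b₁ Mstar) δ₀ α) δ₀ α ρ B₀ N N' Cℓ Kc) (Bl β) (BV β))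
        (BI2 ε β) (θI (β + ε)) ≤ Bεβ ε β) :
    B9.Thm37Printed c35 geo9Y bg
        (fun x => E37AllOfOps
          (W38OfOpsDir (𝔬 x) (𝔡 x) (𝔩 x) (rd x) 1 (H x) (const37 (exp261 (@geo9Y d ℓ hd hL b₀ b₁ Mstar) δ₀ α) δ₀ α ρ B₀ N N' Cℓ Kc)
            ((1 - 2 * α) * δ₀))
          (𝔬 x) 1 (H x) (const37 (exp261 (@geo9Y d ℓ hd hL b₀ b₁ Mstar) δ₀ α) δ₀ α ρ B₀ N N' Cℓ Kc) ((1 - 2 * α) * δ₀)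
          (K x) B₁ δ₁ Bβ Bε Bεβ) ∧
      B9.Cor38Printed c35 geo9Y bg
        (fun x => E37AllOfOps
          (W38OfOpsDir (𝔬 x) (𝔡 x) (𝔩 x) (rd x) 1 (H x) (const37 (exp261 (@geo9Y d ℓ hd hL b₀ b₁ Mstar) δ₀ α) δ₀ α ρ B₀ N N' Cℓ Kc)
            ((1 - 2 * α) * δ₀))
          (𝔬 x) 1 (H x) (const37 (exp261 (@geo9Y d ℓ hd hL b₀ b₁ Mstar) δ₀ α) δ₀ α ρ B₀ N N' Cℓ Kc) ((1 - 2 * α) * δ₀)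
          (K x) B₁ δ₁ Bβ Bε Bεβ) := by
  obtain ⟨Mth, h261, hfacts, -⟩ :=
    lemma21Pack_geo9Y (d := d) (ℓ := ℓ) (hd := hd) (hL := hL) (b₀ := b₀) (b₁ := b₁) (Mstar := Mstar) H hα hα2 hδ₀ hαF
      (by linarith)
  obtain ⟨h37, hc38⟩ := thm37_cor38_W38OfOps_exp261_geo9Y₂ (bg := bg) 𝔬 𝔡 𝔩 rd (fun _ => 1) H κ α ρ N N' Cℓ Kc θ₀ B₀ δ₀ a₁ M₁
    hc hα hα2.le hN hN' hCℓ hK hθ₀ hB₀ hδ₀ ha₁ hM₁ hst hκ hrd hloc h36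
  have hC : 0 ≤ const37 (exp261 (@geo9Y d ℓ hd hL b₀ b₁ Mstar) δ₀ α) δ₀ α ρ B₀ N N' Cℓ Kc :=
    const37_nonneg_of_signs _ hB₀.le hN hN' (zero_le_one.trans hCℓ) hK
  have hδs : 0 < (1 - 2 * α) * δ₀ := mul_pos (by linarith) hδ₀
  refine ⟨?_, (cor38Printed_E37AllOfOps_iff _ 𝔬 (fun _ => 1) H _ _ K B₁ δ₁ Bβ Bε Bεβ).mpr hc38⟩
  exact thm37Printed_allPin_completePairM_dir₃ (geo := geo9Y) (R := fun _ => (1 : ℝ)) 𝔭 𝔡 𝔩 bHX K ev evY Rel m 2 Cev (((ℓ + 1 : ℕ) : ℝ)) mN κ SH Bl BV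
    (exp261 (@geo9Y d ℓ hd hL b₀ b₁ Mstar) δ₀ α) δ₀ α ρ N N' Cℓ Kc θ₀ B₀ NH a₁ M₁ Mth S3 N3 B3 NQ
    SI NI BI θI BI2 SM NM BM θM h37 hRlen hRd₁ hRd₂ hmult hnbr one_le_L_nat len_le_of_dist_le_two_geo9Y
    geo9Y_dist_triangle hCev hco0 hco1 hco2 hco3 hgl0 hgl1 hgl2 hgl3
    hl0 hl1 hl2 hl3 hl4 hl5 hH1 hIR hsym htr hfacts geo9Y_dist_symm hC hCB hCL hδ₁nn (by nlinarith) hδ₁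
    (mul_nonneg hαF.le hδs.le) (by nlinarith) hCg hc ha₁ hα.le hα2.le hN' hB₀.le hNH hM₁ hδs.le le_rfl
    hδ₀.le hN3 hB3 (zero_le_one.trans hCℓ) hNI hNM hBM hθM hB35 hB3M hst hκ hcntH hcnt3 hNQ hcntI hcntM hBl hBV hBI hBI2 hθI hBβ hBε hBεβ h261
    (fun x hM α₀ hα₀ ha U hU => ⟨(h36 x hM α₀ hα₀ ha U hU).1, (h36 x hM α₀ hα₀ ha U hU).2.1, (h36 x hM α₀ hα₀ ha U hU).2.2,
      (h36H x hM α₀ hα₀ ha U hU).1, (h36H x hM α₀ hα₀ ha U hU).2.1⟩)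
    (fun x hM α₀ hα₀ ha U hU => (h36H x hM α₀ hα₀ ha U hU).2.2.1)
    (fun x hM α₀ hα₀ ha U hU => (h36H x hM α₀ hα₀ ha U hU).2.2.2.1)
    (fun x hM α₀ hα₀ ha U hU => (h36H x hM α₀ hα₀ ha U hU).2.2.2.2)

/-! ## §2 Rows 18 ∕ 19, G side: Theorem 3.10 at the literal all-blocks pin, ₃ edition -/

/-- ★★ **(₃ EDITION — `h36H`'s third-order schema `FactorsL2Second310 … θ3 δ₀` REPLACED by the letter transposes `Rₐᵗ = Rₐᵀ`; `θ3 ∕ hθ3` dropped; `hB35` at `NQ·2N₃B₃`; through dag-n06-w1's `B9RWSumsAllBlocksPairMGDir3.thm310Printed_allPin_completePairM_dir₃`; everything else VERBATIM the v2 text that follows.)** **(v2 OVER THE DIRECTION LETTERS, R1′-A: `h36 ∋ DirSupSq310 ∧ Identities310₂`; inside `thm310Printed_exp261_geo9Y₂` + `thm310Printed_allPin_completePairM_dir`; everything else VERBATIM `B9RWSumsCompleteGeo9YPairM.thm310_complete_geo9Y_pairM`.)** ★★ **THEOREM 3.10 AT THE LITERAL ALL-BLOCKS PIN OVER def-Y's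 MEMBERS, FROM OPERATOR-LEVEL INPUTS ONLY, THE (3.43)–(3.46) CO-READINGS SITED ON THE NEIGHBOURHOOD OF RADIUS 2** (the `Nbr` form of `B9RWSumsCompleteGeo9YRel.thm310_complete_geo9Y_rel`, on `B9RWSumsAllBlocksNbr.thm310Printed_allPin_completeNbr`; `geo9Y_dist_triangle`, `geo9Y_dist_symm`, `len_le_of_dist_le_two_geo9Y` by name).  With `C := const37
(exp261 geo9Y δ₀ α) δ₀ α ρ B₀ N N′ C_ℓ K_c`, `δ := (1 − 2α)δ₀` and the pin `W310OfOps (𝔬 x) (rd x) (ConvAll3107 (𝔬 x) 1 (H x) C δ (K x)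
B₁ δ₁ Bβ Bε Bεβ)` (p. 416: *"From (3.108) it follows that the expansion (3.107) is convergent in all norms in the inequalities
(3.42)–(3.47). This implies Theorem 3.3."* READ as Theorem 3.3's typed blocks for `K x`): the leaf `B9.Thm310Printed` holds, given
— the static data (`StaticOK310`, `Sizes310.Bounded`, `WalkReading310.OK`, `Locality310`); Corollary 3.6's blocks for the G_□, (3.89)
and the structure (3.105) (`h36`), the Hölder ∕ probe-factor ∕ Laplacian ∕ input ∕ two-sided L² legs (`h36H`) at
(B₀, δ₀), all POSITED for M ≧ M₁, 0 < α₀, O(1)Mα₀ ≦ a₁, (3.35); the co-readings of `K x`; the transpose letters; the support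
counts; the signs; the relations of (B₁, δ₁, Bβ, Bε, Bεβ) to the derived constants.  [4] Lemma 2.1, 1 ≦ L ≦ ℓ + 1, η > 0 and the
symmetry of d come from the record (`lemma21Pack_geo9Y`, `geo9Y_dist_symm`), the sup-block leaf from `thm310Printed_exp261_geo9Y`,
the rest is `B9RWSumsAllBlocksNbr.thm310Printed_allPin_completeNbr`.  Nothing of print asserted; NOT a node discharge.
[cite: Balaban1985BackgroundPropagators, Thm 3.10 (3.105)–(3.108) pp.413–416 + Thm 3.3 p.399 + Cor. 3.6 p.408 + (3.42)–(3.47) pp.397–398; Balaban1984PropagatorsII, Lemma 2.1 (2.59)–(2.61) pp.233–234] -/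
theorem thm310_complete_geo9Y_pairM_dir₃ {X Y ι A PX PY Q : MemberY d ℓ hd hL b₀ b₁ Mstar → Type} [∀ x, Fintype (X x)]
    [∀ x, DecidableEq (X x)] [∀ x, Fintype (Y x)] [∀ x, DecidableEq (Y x)] [∀ x, Fintype (ι x)] [∀ x, Fintype (A x)]
    [∀ x, Fintype (PX x)] [∀ x, DecidableEq (PX x)] [∀ x, Fintype (PY x)] [∀ x, DecidableEq (PY x)] [∀ x, Fintype (Q x)]
    (𝔬 : ∀ x : MemberY d ℓ hd hL b₀ b₁ Mstar, Ops310 (geo9Y x) (bg x) (X x) (Y x) (ι x) (A x))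
    (rd : ∀ x : MemberY d ℓ hd hL b₀ b₁ Mstar, WalkReading310 (geo9Y x) (bg x) (X x) (ι x) (A x))
    (H : MemberY d ℓ hd hL b₀ b₁ Mstar → Prop)
    (𝔭 : ∀ x : MemberY d ℓ hd hL b₀ b₁ Mstar, HolderProbes (geo9Y x) (bg x) (X x) (Y x) (PX x) (PY x))
    (𝔡 : ∀ x : MemberY d ℓ hd hL b₀ b₁ Mstar, DirOps310 (𝔬 x) (Q x))
    (𝔩 : ∀ x : MemberY d ℓ hd hL b₀ b₁ Mstar, DirLetters310 (𝔬 x) (Q x))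
    (bHX : ∀ x : MemberY d ℓ hd hL b₀ b₁ Mstar, ℝ → BlockNorm (toB6 (geo9Y x) 1 (H x)) (X x → ℝ))
    (K : ∀ x : MemberY d ℓ hd hL b₀ b₁ Mstar, B9.KernelFamily (geo9Y x) (bg x))
    (ev : ∀ x : MemberY d ℓ hd hL b₀ b₁ Mstar, (geo9Y x).Loc → X x → ℝ)
    (evY : ∀ x : MemberY d ℓ hd hL b₀ b₁ Mstar, (geo9Y x).Loc → Y x → ℝ)
    (Rel : ∀ x : MemberY d ℓ hd hL b₀ b₁ Mstar, (geo9Y x).Site → (geo9Y x).Site → Prop) [∀ x, DecidableRel (Rel x)] (m : ℕ)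
    (Cev : ℝ) (mN : ℕ)
    (hRlen : ∀ x (a a' : (geo9Y x).Site), Rel x a a' → (geo9Y x).len a = (geo9Y x).len a')
    (hRd₁ : ∀ x (a a' b : (geo9Y x).Site), Rel x a a' → (geo9Y x).dist a b = (geo9Y x).dist a' b)
    (hRd₂ : ∀ x (a b b' : (geo9Y x).Site), Rel x b b' → (geo9Y x).dist a b = (geo9Y x).dist a b')
    (hmult : ∀ x (y' : (geo9Y x).Site), (Finset.univ.filter (fun y'' => Rel x y'' y')).card ≤ m)
    (hnbr : ∀ (x : MemberY d ℓ hd hL b₀ b₁ Mstar) (y : (geo9Y x).Site), (nbr (geo9Y x) 2 y).card ≤ mN) (hCev : 0 ≤ Cev)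
    (κ : MemberY d ℓ hd hL b₀ b₁ Mstar → Sizes310)
    (SH S3 SI SM : ∀ x : MemberY d ℓ hd hL b₀ b₁ Mstar, ι x → Finset (geo9Y x).Site)
    (Bl θH BI θI : ℝ → ℝ) (BI2 : ℝ → ℝ → ℝ)
    (α ρ N N' NF Cℓ Kc θ₀ B₀ δ₀ a₁ M₁ αF NH N3 B3 NQ NI NM BM θM : ℝ) {B₁ δ₁ : ℝ} {Bβ Bε : ℝ → ℝ} {Bεβ : ℝ → ℝ → ℝ}
    (hc : 0 < c35) (hα : 0 < α) (hα2 : α < 1 / 2) (hN : 0 ≤ N) (hN' : 0 ≤ N') (hNF : 0 ≤ NF) (hCℓ : 1 ≤ Cℓ) (hK : 0 ≤ Kc)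
    (hθ₀ : 0 ≤ θ₀) (hB₀ : 0 < B₀) (hδ₀ : 0 < δ₀) (ha₁ : 0 < a₁) (hM₁ : 0 < M₁) (hαF : 0 < αF) (hαF2 : αF ≤ 1 / 2)
    (hNH : 0 ≤ NH) (hN3 : 0 ≤ N3) (hB3 : 0 ≤ B3) (hNI : 0 ≤ NI) (hNM : 0 ≤ NM) (hBM : 0 ≤ BM) (hθM : 0 ≤ θM)
    (hst : ∀ x, StaticOK310 (𝔬 x) ρ N N' NF Cℓ (κ x)) (hκ : ∀ x, (κ x).Bounded Kc)
    (hrd : ∀ x, (rd x).OK (𝔬 x).blk) (hloc : ∀ x, Locality310 (𝔬 x) (rd x))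
    (h36 : ∀ x, M₁ ≤ (geo9Y x).M → ∀ α₀ : ℝ, 0 < α₀ → c35 * (geo9Y x).M * α₀ ≤ a₁ →
      ∀ U : (bg x).Cfg, (bg x).Reg335 c35 α₀ U →
        Local342G (𝔬 x) 1 (H x) B₀ δ₀ U ∧ B9Thm310Whole.Factors389 (𝔬 x) 1 (H x) θ₀ δ₀ U ∧ DirSupSq310 (𝔬 x) (𝔡 x) 1 (H x) U ∧
          Identities310₂ (𝔬 x) (𝔡 x) (𝔩 x) 1 (H x) U)
    (h36H : ∀ x, M₁ ≤ (geo9Y x).M → ∀ α₀ : ℝ, 0 < α₀ → c35 * (geo9Y x).M * α₀ ≤ a₁ →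
      ∀ U : (bg x).Cfg, (bg x).Reg335 c35 α₀ U →
        HolderLegs310 (𝔬 x) (𝔭 x) 1 (H x) (SH x) Bl δ₀ U ∧ FactorsHolder310 (𝔬 x) (𝔭 x) 1 (H x) θH δ₀ U ∧
          (L2SecondLegs310 (𝔬 x) (𝔡 x) 1 (H x) (S3 x) B3 δ₀ U ∧ (∀ a, IsTransposePair ((𝔬 x).Rt U a) ((𝔬 x).Rf U a)) ∧
            DirTranspose310 (𝔬 x) (𝔡 x) U) ∧
            (InputLegsPair310 (𝔬 x) (𝔡 x) (𝔭 x) 1 (H x) (bHX x) (SI x) BI BI2 δ₀ U ∧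
              FactorsInputPair310 (𝔬 x) (𝔡 x) 1 (H x) (bHX x) θI δ₀ U ∧ DirSupHolder310 (𝔬 x) (𝔡 x) (𝔭 x) 1 (H x) U) ∧
              (L2MixedLegs310 (𝔬 x) (𝔡 x) 1 (H x) (SM x) BM δ₀ U ∧ FactorsL2Mixed310 (𝔬 x) (𝔡 x) 1 (H x) θM δ₀ U ∧
                DirSup310 (𝔬 x) (𝔡 x) 1 (H x) U))
    (hco0 : ∀ x U, CoRealizesRel (K x) 0 U (Rel x) (𝔬 x).blk (𝔬 x).blk (ev x) ((𝔬 x).G U))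
    (hco1 : ∀ x U, CoRealizesRel (K x) 1 U (Rel x) (𝔬 x).blkY (𝔬 x).blk (ev x) ((𝔬 x).D U ∘ₗ (𝔬 x).G U))
    (hco2 : ∀ x U, CoRealizesRel (K x) 2 U (Rel x) (𝔬 x).blk (𝔬 x).blkY (evY x) ((𝔬 x).G U ∘ₗ (𝔬 x).Dstar U))
    (hco3 : ∀ x U, CoRealizesRel (K x) 3 U (Rel x) (𝔬 x).blk (𝔬 x).blk (ev x) ((𝔬 x).Lap U ∘ₗ (𝔬 x).G U))
    (hgl0 : ∀ x U, GlobReads (K x) 0 U (𝔬 x).blk (𝔬 x).blk (ev x) ((𝔬 x).G U))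
    (hgl1 : ∀ x U, GlobReads (K x) 1 U (𝔬 x).blkY (𝔬 x).blk (ev x) ((𝔬 x).D U ∘ₗ (𝔬 x).G U))
    (hgl2 : ∀ x U, GlobReads (K x) 2 U (𝔬 x).blk (𝔬 x).blkY (evY x) ((𝔬 x).G U ∘ₗ (𝔬 x).Dstar U))
    (hgl3 : ∀ x U, GlobReads (K x) 3 U (𝔬 x).blk (𝔬 x).blk (ev x) ((𝔬 x).Lap U ∘ₗ (𝔬 x).G U))
    (hl0 : ∀ x U, L2ReadsNbr (R := 1) (H := H x) (K x) 0 U (Rel x) 2 Cev (𝔬 x).blk (𝔬 x).blk (ev x) ((𝔬 x).G U))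
    (hl1 : ∀ x U, L2ReadsNbr (R := 1) (H := H x) (K x) 1 U (Rel x) 2 Cev (𝔬 x).blkY (𝔬 x).blk (ev x) ((𝔬 x).D U ∘ₗ (𝔬 x).G U))
    (hl2 : ∀ x U, L2ReadsNbr (R := 1) (H := H x) (K x) 2 U (Rel x) 2 Cev (𝔬 x).blk (𝔬 x).blkY (evY x) ((𝔬 x).G U ∘ₗ (𝔬 x).Dstar U))
    (hl3 : ∀ x U, L2ReadsNbr (R := 1) (H := H x) (K x) 3 U (Rel x) 2 Cev ((𝔬 x).blk ∘ Prod.fst) (𝔬 x).blk (ev x)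
      (familyOp fun p : Q x × Q x => (𝔡 x).Dd U p.1 ∘ₗ ((𝔬 x).G U ∘ₗ (𝔡 x).Dsd U p.2)))
    (hl4 : ∀ x U, L2ReadsNbr (R := 1) (H := H x) (K x) 4 U (Rel x) 2 Cev ((𝔬 x).blk ∘ Prod.fst) (𝔬 x).blk (ev x)
      (familyOp fun p : Q x × Q x => ((𝔡 x).Dd U p.1 ∘ₗ (𝔡 x).Dd U p.2) ∘ₗ (𝔬 x).G U))
    (hl5 : ∀ x U, L2ReadsNbr (R := 1) (H := H x) (K x) 5 U (Rel x) 2 Cev ((𝔬 x).blk ∘ Prod.fst) (𝔬 x).blk (ev x)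
      (familyOp fun p : Q x × Q x => (𝔬 x).G U ∘ₗ ((𝔡 x).Dsd U p.1 ∘ₗ (𝔡 x).Dsd U p.2)))
    (hH1 : ∀ x U, H1ReadsNbr (K x) U (𝔭 x) (Rel x) 2 (𝔬 x).blk (𝔬 x).blkY (ev x) (evY x) ((𝔬 x).D U ∘ₗ (𝔬 x).G U)
      ((𝔬 x).G U ∘ₗ (𝔬 x).Dstar U))
    (hIR : ∀ x U, InputReadsFam (K x) U (bHX x) 2 ((𝔬 x).blk ∘ Prod.fst) ((𝔭 x).blkPX ∘ Prod.fst)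
      (fun β => sliceProbe ((𝔭 x).ΦX U β)) (ev x)
      (familyOp fun p : Q x × Q x => (𝔡 x).Dd U p.1 ∘ₗ ((𝔬 x).G U ∘ₗ (𝔡 x).Dsd U p.2)))
    (hsym : ∀ x, M₁ ≤ (geo9Y x).M → ∀ α₀ : ℝ, 0 < α₀ → c35 * (geo9Y x).M * α₀ ≤ a₁ →
      ∀ U : (bg x).Cfg, (bg x).Reg335 c35 α₀ U → IsTransposePair ((𝔬 x).G U) ((𝔬 x).G U))
    (htr : ∀ x, M₁ ≤ (geo9Y x).M → ∀ α₀ : ℝ, 0 < α₀ → c35 * (geo9Y x).M * α₀ ≤ a₁ →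
      ∀ U : (bg x).Cfg, (bg x).Reg335 c35 α₀ U → IsTransposePair ((𝔬 x).D U ∘ₗ (𝔬 x).G U) ((𝔬 x).G U ∘ₗ (𝔬 x).Dstar U))
    (hcntH : ∀ x (a : (geo9Y x).Site), (∑ q, if a ∈ SH x q then (1 : ℝ) else 0) ≤ NH)
    (hcnt3 : ∀ x (a : (geo9Y x).Site), (∑ q, if a ∈ S3 x q then (1 : ℝ) else 0) ≤ N3)
    (hNQ : ∀ x, (Fintype.card (Q x) : ℝ) ≤ NQ)
    (hcntI : ∀ x (a : (geo9Y x).Site), (∑ q, if a ∈ SI x q then (1 : ℝ) else 0) ≤ NI)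
    (hcntM : ∀ x (a : (geo9Y x).Site), (∑ q, if a ∈ SM x q then (1 : ℝ) else 0) ≤ NM)
    (hBl : ∀ β, 0 ≤ β → β < 1 → 0 ≤ Bl β) (hθH : ∀ β, 0 ≤ β → β < 1 → 0 ≤ θH β)
    (hBI : ∀ ε, 0 < ε → ε ≤ 1 → 0 ≤ BI ε) (hBI2 : ∀ ε β, 0 < ε → ε ≤ 1 → 0 ≤ β → β < 1 → 0 ≤ BI2 ε β)
    (hθI : ∀ ε, 0 < ε → 0 ≤ θI ε)
    -- the relations of the all-blocks constants (B₁, δ₁, Bβ, Bε, Bεβ) to the definite derived ones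
    (hCB : (m : ℝ) * const37 (exp261 (@geo9Y d ℓ hd hL b₀ b₁ Mstar) δ₀ α) δ₀ α ρ B₀ N N' Cℓ Kc ≤ B₁)
    (hCL : (mN : ℝ) * m * Cev * (((ℓ + 1 : ℕ) : ℝ)) ^ 2 * Real.exp (2 * δ₁) * 
      (const37 (exp261 (@geo9Y d ℓ hd hL b₀ b₁ Mstar) δ₀ α) δ₀ α ρ B₀ N N' Cℓ Kc * ((ℓ + 1 : ℕ) : ℝ)) ≤ B₁)
    (hδ₁nn : 0 ≤ δ₁) (hδ₁ : δ₁ ≤ (1 - 2 * αF) * ((1 - 2 * α) * δ₀))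
    (hCg : const37 (exp261 (@geo9Y d ℓ hd hL b₀ b₁ Mstar) δ₀ α) δ₀ α ρ B₀ N N' Cℓ Kc *
      B6.c1 (exp261 (@geo9Y d ℓ hd hL b₀ b₁ Mstar) ((1 - 2 * α) * δ₀) (1 - αF)) ((1 - 2 * α) * δ₀) (1 - αF) *
        ((ℓ + 1 : ℕ) : ℝ) ^ (4 : ℝ) ≤ B₁)
    (hB35 : (mN : ℝ) * m * Cev * (((ℓ + 1 : ℕ) : ℝ)) ^ 2 * Real.exp (2 * δ₁) * 
      (NQ * (2 * (N3 * B3))) ≤ B₁)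
    (hB3M : (mN : ℝ) * m * Cev * (((ℓ + 1 : ℕ) : ℝ)) ^ 2 * Real.exp (2 * δ₁) *
      (NQ * mixedConst (exp261 (@geo9Y d ℓ hd hL b₀ b₁ Mstar) δ₀ α) δ₀ α NM BM NF θM
        (const37 (exp261 (@geo9Y d ℓ hd hL b₀ b₁ Mstar) δ₀ α) δ₀ α ρ B₀ N N' Cℓ Kc) ((ℓ + 1 : ℕ) : ℝ)) ≤ B₁)
    (hBβ : ∀ β, 0 ≤ β → β < 1 →
      (m : ℝ) * ((ℓ + 1 : ℕ) : ℝ) * Real.exp (2 * δ₁) * holderConst (exp261 (@geo9Y d ℓ hd hL b₀ b₁ Mstar) δ₀ α) δ₀ α NH NF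
        (const37 (exp261 (@geo9Y d ℓ hd hL b₀ b₁ Mstar) δ₀ α) δ₀ α ρ B₀ N N' Cℓ Kc) (Bl β) (θH β) ≤ Bβ β)
    (hBε : ∀ ε, 0 < ε → ε ≤ 1 →
      Real.exp (2 * δ₁) * inputConst44 (exp261 (@geo9Y d ℓ hd hL b₀ b₁ Mstar) δ₀ α) δ₀ α NI NF
        (const37 (exp261 (@geo9Y d ℓ hd hL b₀ b₁ Mstar) δ₀ α) δ₀ α ρ B₀ N N' Cℓ Kc) ((ℓ + 1 : ℕ) : ℝ) (BI ε) (θI ε) ≤ Bε ε)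
    (hBεβ : ∀ ε β, 0 < ε → ε ≤ 1 → 0 ≤ β → β < 1 →
      ((ℓ + 1 : ℕ) : ℝ) * Real.exp (2 * δ₁) * inputConst45 (exp261 (@geo9Y d ℓ hd hL b₀ b₁ Mstar) δ₀ α) δ₀ α NI NF ((ℓ + 1 : ℕ) : ℝ)
        (holderConst (exp261 (@geo9Y d ℓ hd hL b₀ b₁ Mstar) δ₀ α) δ₀ α NH NF
          (const37 (exp261 (@geo9Y d ℓ hd hL b₀ b₁ Mstar) δ₀ α) δ₀ α ρ B₀ N N' Cℓ Kc) (Bl β) (θH β))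
        (BI2 ε β) (θI (β + ε)) ≤ Bεβ ε β) :
    B9.Thm310Printed c35 geo9Y bg
      (fun x => W310OfOps (𝔬 x) (rd x)
        (ConvAll3107 (𝔬 x) 1 (H x) (const37 (exp261 (@geo9Y d ℓ hd hL b₀ b₁ Mstar) δ₀ α) δ₀ α ρ B₀ N N' Cℓ Kc)
          ((1 - 2 * α) * δ₀) (K x) B₁ δ₁ Bβ Bε Bεβ)) := by
  obtain ⟨Mth, h261, hfacts, -⟩ :=
    lemma21Pack_geo9Y (d := d) (ℓ := ℓ) (hd := hd) (hL := hL) (b₀ := b₀) (b₁ := b₁) (Mstar := Mstar) H hα hα2 hδ₀ hαF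
      (by linarith)
  have h310 := thm310Printed_exp261_geo9Y₂ (bg := bg) 𝔬 𝔡 𝔩 rd (fun _ => 1) H κ α ρ N N' NF Cℓ Kc θ₀ B₀ δ₀ a₁ M₁ hc hα hα2.le hN
    hN' hNF hCℓ hK hθ₀ hB₀ hδ₀ ha₁ hM₁ hst hκ hrd hloc h36
  have hC : 0 ≤ const37 (exp261 (@geo9Y d ℓ hd hL b₀ b₁ Mstar) δ₀ α) δ₀ α ρ B₀ N N' Cℓ Kc :=
    const37_nonneg_of_signs _ hB₀.le hN hN' (zero_le_one.trans hCℓ) hK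
  have hδs : 0 < (1 - 2 * α) * δ₀ := mul_pos (by linarith) hδ₀
  exact thm310Printed_allPin_completePairM_dir₃ (geo := geo9Y) (R := fun _ => (1 : ℝ)) 𝔭 𝔡 𝔩 bHX K ev evY Rel m 2 Cev (((ℓ + 1 : ℕ) : ℝ)) mN κ SH Bl θH
    (exp261 (@geo9Y d ℓ hd hL b₀ b₁ Mstar) δ₀ α) δ₀ α ρ N N' NF Cℓ θ₀ NH a₁ M₁ Mth S3 N3 B3 NQ
    SI NI BI θI BI2 SM NM BM θM h310 hRlen hRd₁ hRd₂ hmult hnbr one_le_L_nat len_le_of_dist_le_two_geo9Y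
    geo9Y_dist_triangle hCev hco0 hco1 hco2 hco3 hgl0 hgl1 hgl2 hgl3
    hl0 hl1 hl2 hl3 hl4 hl5 hH1 hIR hsym htr hfacts geo9Y_dist_symm hC hCB hCL hδ₁nn (by nlinarith) hδ₁
    (mul_nonneg hαF.le hδs.le) (by nlinarith) hCg hc ha₁ hα.le hα2.le hNF hθ₀ hNH hδs.le le_rfl hδ₀.le hN3 hB3 hNI hNM hBM
    hθM hB35 hB3M hst hcntH hcnt3 hNQ hcntI hcntM hBl hθH hBI hBI2 hθI hBβ hBε hBεβ h261
    (fun x hM α₀ hα₀ ha U hU => ⟨(h36 x hM α₀ hα₀ ha U hU).2.1, (h36 x hM α₀ hα₀ ha U hU).2.2.2, (h36H x hM α₀ hα₀ ha U hU).1,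
      (h36H x hM α₀ hα₀ ha U hU).2.1⟩)
    (fun x hM α₀ hα₀ ha U hU => (h36H x hM α₀ hα₀ ha U hU).2.2.1)
    (fun x hM α₀ hα₀ ha U hU => (h36H x hM α₀ hα₀ ha U hU).2.2.2.1)
    (fun x hM α₀ hα₀ ha U hU => (h36H x hM α₀ hα₀ ha U hU).2.2.2.2)

end StageY

end

end Literature.MathematicalPhysics.QuantumFieldTheory.Balaban1983to89.B9RWSumsDefinitePinsPairMDir3
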